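import Summits.CriticalPhenomena.SAWScalingLimit.Theorems.SAWLeftRightFKGFKGToTraversalBoundGatesDefs
import HarnessLib

/-!
# Slit necklace, piece 2: the Markov step from the germ excursion mean

Crux `SAWLeftRightFKG.FKGToTraversalBound` (stmt-CriticalPhenomena-1878), line
`gates-by-bubble-doors-by-fkg`, registered helpers `necklace_traversalTail_of_tsum_le` (def-free) and
`necklace_germMarkov` (over the vocabulary name `GermExcursionMean`) of the stub `stub_necklace`
(`SAWCollarBound → GermExcursionMean → DeepShellTight`).

The necklace accounting bounds the number of FAR pieces of a deep-endpoint chord by half the number of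
separate traversals of the crossover annulus `D(δ a_δ; 1.1 d, C₀ d)`, `d = dist(δ a_δ, ∂D)`, and the
line's input `GermExcursionMean` controls the EXPECTATION of that count,
`E[N] = Σ_{k ≥ 0} P(N ≥ k + 1) ≤ M̄`, uniformly in the mesh.  What the union bound over piece slots
consumes is a QUANTILE: for every `ε > 0` one threshold `n` with `P_δ(N ≥ n + 1) ≤ ε` for all meshes in
range.  This is Markov's inequality for a family of events antitone in `k`
(`Curve.HasTraversals.of_le`): `(n + 1) · P(N ≥ n + 1) ≤ Σ_{k ≤ n} P(N ≥ k + 1) ≤ Σ_k P(N ≥ k + 1) ≤ M̄`.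

* `succ_mul_measure_le_tsum_of_antitone` — `(n + 1) μ(E n) ≤ Σ' k, μ(E k)` for an antitone family;
* `measure_le_ofReal_of_tsum_le` — hence `μ(E n) ≤ ε` as soon as `M̄ ≤ (n + 1) ε`;
* `necklace_traversalTail_of_tsum_le` (registered, def-free) — for ANY family of shells
  `D(x_δ; ρ_δ, R_δ)` and any set of meshes on which the expected traversal count is `≤ M̄`, one
  threshold `n = n(M̄, ε)` bounds the tail uniformly;
* `necklace_germMarkov` (registered) — the form the necklace consumes: from `GermExcursionMean`, for
  every endpoint approximation, `C₀ > 11/10`, `δ₀ > 0` and for every `ε > 0` a threshold `n` with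
  `P_δ(n + 1 separate traversals of the crossover annulus) ≤ ε` at `a` and at `b`, for all
  `δ ∈ (0, δ₀]`.

Only theorems; no named fact; axioms are the standard three.
-/

noncomputable section

open MeasureTheory Filter Topology Set Metric
open scoped NNReal ENNReal
open Literature.Probability.LatticeModels
open Literature.Probability.RandomPlanarGeometry
open Literature.Probability.RandomPlanarGeometry.SAW
open Summit.CriticalPhenomena.SAWScalingLimit.Theses.SAWLeftRightFKG

namespace Summit.CriticalPhenomena.SAWScalingLimit.Theorems.FKGToTraversalBound.GatesByBubbleDoorsByFKG

/-! ### Markov's inequality for an antitone family of events -/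

/-- **Partial Markov.**  For an antitone family of sets `E 0 ⊇ E 1 ⊇ ⋯`,
`(n + 1) · μ(E n) ≤ Σ_{k ≤ n} μ(E k) ≤ Σ' k, μ(E k)`. [folklore] -/
theorem succ_mul_measure_le_tsum_of_antitone {α : Type*} [MeasurableSpace α] (μ : Measure α)
    {E : ℕ → Set α} (hE : Antitone E) (n : ℕ) :
    ((n : ℝ≥0∞) + 1) * μ (E n) ≤ ∑' k, μ (E k) := by
  calc ((n : ℝ≥0∞) + 1) * μ (E n) = ∑ _k ∈ Finset.range (n + 1), μ (E n) := by
        rw [Finset.sum_const, Finset.card_range, nsmul_eq_mul]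
        push_cast
        ring
    _ ≤ ∑ k ∈ Finset.range (n + 1), μ (E k) := by
        refine Finset.sum_le_sum fun k hk => measure_mono (hE ?_)
        exact Nat.lt_succ_iff.1 (Finset.mem_range.1 hk)
    _ ≤ ∑' k, μ (E k) := ENNReal.sum_le_tsum _

/-- **Markov quantile.**  If the family `E` is antitone, `Σ' k, μ(E k) ≤ M̄` and `M̄ ≤ (n + 1) ε`,
then `μ(E n) ≤ ε`. [folklore] -/
theorem measure_le_ofReal_of_tsum_le {α : Type*} [MeasurableSpace α] (μ : Measure α)
    {E : ℕ → Set α} (hE : Antitone E) {Mbar ε : ℝ}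
    (hsum : ∑' k, μ (E k) ≤ ENNReal.ofReal Mbar) {n : ℕ} (hn : Mbar ≤ ((n : ℝ) + 1) * ε) :
    μ (E n) ≤ ENNReal.ofReal ε := by
  have h1 : ((n : ℝ≥0∞) + 1) * μ (E n) ≤ ENNReal.ofReal (((n : ℝ) + 1) * ε) :=
    ((succ_mul_measure_le_tsum_of_antitone μ hE n).trans hsum).trans (ENNReal.ofReal_le_ofReal hn)
  have h2 : ENNReal.ofReal (((n : ℝ) + 1) * ε) = ((n : ℝ≥0∞) + 1) * ENNReal.ofReal ε := by
    rw [ENNReal.ofReal_mul (by positivity)]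
    congr 1
    rw [ENNReal.ofReal_add (by positivity) zero_le_one, ENNReal.ofReal_natCast, ENNReal.ofReal_one]
  rw [h2] at h1
  have hne0 : ((n : ℝ≥0∞) + 1) ≠ 0 := by positivity
  have hnetop : ((n : ℝ≥0∞) + 1) ≠ ⊤ := by simp
  exact (ENNReal.mul_le_mul_iff_right hne0 hnetop).1 h1

/-- The traversal events of a fixed shell are antitone in the number of traversals
(`Curve.HasTraversals.of_le`). [folklore] -/
theorem antitone_traversalEvent {Ω : Set ℂ} {δ : ℝ} {u v : Site 2} (x : ℂ) (ρ R : ℝ) :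
    Antitone fun k : ℕ => {γ : DomainSAW Ω δ u v |
      (⟨γ.walk.toCurve (meshPoint δ)⟩ : Curve ℂ).HasTraversals (k + 1) x ρ R} :=
  fun _ _ hjk _ hγ => Curve.HasTraversals.of_le hγ (Nat.succ_le_succ hjk)

/-- **Registered helper `necklace_traversalTail_of_tsum_le`** (crux stmt-CriticalPhenomena-1878, stub
`stub_necklace`; DEF-FREE): **a mesh-uniform bound on the expected traversal count gives a mesh-uniform
quantile.**  For any family of shells `D(x_δ; ρ_δ, R_δ)` and any set `S` of meshes on which
`Σ_k P_δ(k + 1 separate traversals) ≤ M̄`, and every `ε > 0`, ONE threshold `n` (any `n` with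
`M̄ ≤ (n + 1) ε`) has `P_δ(n + 1 separate traversals) ≤ ε` for every `δ ∈ S` (Markov's inequality,
`measure_le_ofReal_of_tsum_le`, for the antitone family `antitone_traversalEvent`). [folklore] -/
theorem necklace_traversalTail_of_tsum_le :
    ∀ (D : DobrushinDomain) (a b : ℝ → Site 2) (x : ℝ → ℂ) (ρ R : ℝ → ℝ) (S : Set ℝ) (Mbar : ℝ),
      (∀ δ ∈ S, (∑' k : ℕ, SAW.law D.carrier δ (a δ) (b δ)
          {γ | (⟨γ.walk.toCurve (meshPoint δ)⟩ : Curve ℂ).HasTraversals (k + 1) (x δ) (ρ δ) (R δ)})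
        ≤ ENNReal.ofReal Mbar) →
      ∀ ε : ℝ, 0 < ε → ∃ n : ℕ, ∀ δ ∈ S,
        SAW.law D.carrier δ (a δ) (b δ)
            {γ | (⟨γ.walk.toCurve (meshPoint δ)⟩ : Curve ℂ).HasTraversals (n + 1) (x δ) (ρ δ) (R δ)} ≤
          ENNReal.ofReal ε := by
  intro D a b x ρ R S Mbar hsum ε hε
  obtain ⟨n, hn⟩ := exists_nat_ge (Mbar / ε)
  refine ⟨n, fun δ hδ => ?_⟩
  have hMn : Mbar ≤ ((n : ℝ) + 1) * ε := by
    have h1 : Mbar / ε ≤ (n : ℝ) + 1 := hn.trans (by linarith)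
    rw [div_le_iff₀ hε] at h1
    exact h1
  exact measure_le_ofReal_of_tsum_le (law D.carrier δ (a δ) (b δ))
    (antitone_traversalEvent (x δ) (ρ δ) (R δ)) (hsum δ hδ) hMn

/-- **Registered helper `necklace_germMarkov`** (crux stmt-CriticalPhenomena-1878, stub `stub_necklace`):
**the Markov step of the necklace.**  From `GermExcursionMean`, for every endpoint approximation there
are `C₀ > 11/10` and `δ₀ > 0` such that for every `ε > 0` ONE threshold `n` makes `n + 1` separate
traversals of the crossover annulus `D(δ e_δ; 1.1 d_e, C₀ d_e)`, `d_e = dist(δ e_δ, ℂ ∖ D)`, have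
probability `≤ ε` at both marked points `e = a, b`, for all `δ ∈ (0, δ₀]`
(`necklace_traversalTail_of_tsum_le` twice, `n := max`). [folklore] -/
theorem necklace_germMarkov :
    GermExcursionMean → ∀ (D : DobrushinDomain) (a b : ℝ → Site 2), IsEndpointApprox D a b →
      ∃ (C₀ δ₀ : ℝ), 11 / 10 < C₀ ∧ 0 < δ₀ ∧ ∀ ε : ℝ, 0 < ε → ∃ n : ℕ, ∀ δ ∈ Set.Ioc (0 : ℝ) δ₀,
        SAW.law D.carrier δ (a δ) (b δ)
            {γ | (⟨γ.walk.toCurve (meshPoint δ)⟩ : Curve ℂ).HasTraversals (n + 1) (meshPoint δ (a δ))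
              (11 / 10 * infDist (meshPoint δ (a δ)) D.carrierᶜ)
              (C₀ * infDist (meshPoint δ (a δ)) D.carrierᶜ)} ≤ ENNReal.ofReal ε ∧
        SAW.law D.carrier δ (a δ) (b δ)
            {γ | (⟨γ.walk.toCurve (meshPoint δ)⟩ : Curve ℂ).HasTraversals (n + 1) (meshPoint δ (b δ))
              (11 / 10 * infDist (meshPoint δ (b δ)) D.carrierᶜ)
              (C₀ * infDist (meshPoint δ (b δ)) D.carrierᶜ)} ≤ ENNReal.ofReal ε := by
  intro hG D a b hab
  obtain ⟨Mbar, C₀, δ₀, hC₀, hδ₀, H⟩ := hG D a b hab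
  refine ⟨C₀, δ₀, hC₀, hδ₀, fun ε hε => ?_⟩
  obtain ⟨n₁, hn₁⟩ := necklace_traversalTail_of_tsum_le D a b (fun δ => meshPoint δ (a δ))
    (fun δ => 11 / 10 * infDist (meshPoint δ (a δ)) D.carrierᶜ)
    (fun δ => C₀ * infDist (meshPoint δ (a δ)) D.carrierᶜ) (Set.Ioc (0 : ℝ) δ₀) Mbar
    (fun δ hδ => (H δ hδ).1) ε hε
  obtain ⟨n₂, hn₂⟩ := necklace_traversalTail_of_tsum_le D a b (fun δ => meshPoint δ (b δ))
    (fun δ => 11 / 10 * infDist (meshPoint δ (b δ)) D.carrierᶜ)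
    (fun δ => C₀ * infDist (meshPoint δ (b δ)) D.carrierᶜ) (Set.Ioc (0 : ℝ) δ₀) Mbar
    (fun δ hδ => (H δ hδ).2) ε hε
  refine ⟨max n₁ n₂, fun δ hδ => ⟨?_, ?_⟩⟩
  · refine le_trans (measure_mono fun γ hγ => ?_) (hn₁ δ hδ)
    exact Curve.HasTraversals.of_le hγ (Nat.succ_le_succ (le_max_left _ _))
  · refine le_trans (measure_mono fun γ hγ => ?_) (hn₂ δ hδ)
    exact Curve.HasTraversals.of_le hγ (Nat.succ_le_succ (le_max_right _ _))

end Summit.CriticalPhenomena.SAWScalingLimit.Theorems.FKGToTraversalBound.GatesByBubbleDoorsByFKG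

end
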